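import Summits.BirchSwinnertonDyer.BirchSwinnertonDyer.Theorems.ErratumRoadFiveEulerHalfGenusClassDataSupplyOfPrintedFacts
import Summits.BirchSwinnertonDyer.BirchSwinnertonDyer.Theorems.ErratumRoadFiveEulerHalfGenusLineTwinsGlue
import HarnessLib

/-!
# Route `ErratumRoadFive`, crux `EulerHalfPOnlyMultPotMultTwinAtFive` (23444), line `genus` v2.3: the GROSS → ZHANG TRANSPORT of the
# swap supply — from `ShimuraWalk.SwapSupplyAt hK S.ιc W N_W p ys` (Gross currency: `Conductor`, `frobLevelIndex`, `ShimuraWalk.mdiv` of the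
# labelled family `ys`) to the `hswap` binder of `GenusLine.genusKolyvaginPointDivAtP_of_swap_of_prop53_of_thm63` (Zhang currency:
# square-free conductors on `Zhang2014.IsKolyvaginPrime`, `Zhang2014.levelIndex`, ANY depth function characterised by the
# `p^u`-divisibility of all the points `genusFamilyPoint … δ`)
# (seat `bsd-idea-9` g27, line owner; helper `--supports stmt-BirchSwinnertonDyer-23444 --as helper`)

THEOREMS ONLY (no definition, no named fact, no `sorry`).  HONEST FRAMING: dictionary work; conditional on the displayed binders (a served
`FrameProfile`, modularity data `DtW`, the labels `hL` ∕ `hid` of `GenusLabelsSupplyOddAt`, printed fact G1 for adapter A, and an ABSTRACT swap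
supply `hsw` in Gross currency — supplied on every served frame by `ShimuraWalk.genusSwapSupplyAt_of_frameProfile`, imc-p1 g42, p734410, not
imported here); nothing about any curve is asserted unconditionally; BSD is proved for no curve; items 19715 ∕ 20529 ∕ 23444 stay open.

WHAT.
* `forall_genusDatum_pDiv_iff_le_mdiv_of_frameProfile` — THE DEPTH DICTIONARY per Zhang–Kolyvagin level `n` of index `≥ k ≥ 1`, below `k`:
  `(∀ δ, p^μ ∣ P(n, δ)) ↔ μ ≤ ShimuraWalk.mdiv … ys p n` (`μ ≤ k`) = adapter A `forall_genusDatum_pDiv_iff_pDiv` (imc-p1 g42, p730113) read through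
  `ShimuraWalk.natCast_le_mdiv_iff`, fed VERBATIM as in `addOrderOf_kolyvaginClass_of_genusDepth` (FamilyPackage): `n ⊥ N_{E′}`
  (`coprime_conductorNorm_E'_of_kolyvaginLevel`), Gross primes of level `k` (`grossKolyvagin_level_of_frameProfile`), the weak (B4) label off
  `LabelsAt` at the guard `2N_W` (`guard_two_mul_level_of_frameProfile`).
* `zhangConductor_of_grossLevel` ∕ `grossConductor_of_zhang_of_frameProfile` — Gross Kolyvagin primes of Frobenius level `M ≥ 1` are Zhang–Kolyvagin
  primes of index `≥ M` (`zhang_isKolyvaginPrime_of_kolyvaginPrime`, via `DtW`) and conversely on a served frame (`grossKolyvagin_of_zhang_of_frameProfile`);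
  as `ℕ∞`-inequalities `M ≤ frobLevelIndex ↔ M ≤ levelIndex` on such conductors (`le_frobLevelIndex_of_le_levelIndex_of_frameProfile`,
  `zhang_level_of_le_frobLevelIndex`).
* `genusSwapZhang_of_swapSupplyAt` — THE TRANSPORT: from `hsw : SwapSupplyAt hprof.quad S.ιc W N_W p ys`, for every depth function `mdiv` on the
  Zhang conductors with `u ≤ mdiv c ↔ ∀ δ, p^u ∣ P(c, δ)`, the swap statement in Zhang currency (the File-5 binder `hswap` AT THIS FRAME).  Proof:
  move `c` to Gross currency; hypotheses (2) and (3) cross by the depth dictionary at depth `μ`, `μ+1 ≤ M`; apply `hsw` at `e' := max e (μ+1)` (so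
  that the returned conductor has level `≥ μ+1 ≥ 1`: its primes are Zhang of index `≥ e`, and the dictionary applies at depth `μ+1`); cross back.
[cite: McCallumLMS1991, §5 Prop. 5.2 (pp. 304–306), §5 (p. 303)] [cite: GrossLMS1991, §3 (3.1)–(3.3), §4 (4.1)] [cite: WZhang2014, Notations (xii)]
[cite: Jetchev2008, §3.1 items 2, 5 (p. 817)]
presearch: «Kolyvagin prime index M(l) Gross Frobenius condition Zhang M(n) dictionary» → [corpus: GrossLMS1991 §3 (3.3); WZhang2014 Notations (xii)] (the
two currencies; the equivalence under `p^M ∣ a_ℓ, ℓ+1` is Gross (3.3)); `lean search 'SwapSupplyAt'` → CR3 defs + producers, no Zhang-currency consumer.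
-/

set_option autoImplicit false

set_option linter.dupNamespace false

noncomputable section

open scoped Classical

open WeierstrassCurve NumberField Field Literature.NumberTheory.EllipticCurves Literature.NumberTheory.EllipticCurves.ModularForms
  Literature.NumberTheory.GaloisRepresentations Literature.NumberTheory.GaloisRepresentations.DiscreteGaloisModule
  Literature.NumberTheory.EllipticCurves.KolyvaginCocycle
  Summit.BirchSwinnertonDyer.Rank1Residual Summit.BirchSwinnertonDyer.Rank1Residual.X11b
  Summit.BirchSwinnertonDyer.Rank1Residual.JET

namespace Summit.BirchSwinnertonDyer.BirchSwinnertonDyer.Theorems.GenusLine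

variable {W A : WeierstrassCurve ℚ} {p q : ℕ} {K : Type} [Field K] [NumberField K]

/-! ## §1 The two currencies of Kolyvagin conductors on a served frame -/

/-- **Gross level `M ≥ 1` ⟹ Zhang index `≥ M`** at every prime of a level (`zhang_isKolyvaginPrime_of_kolyvaginPrime` prime by prime; `W` modular
by `DtW`).  [cite: GrossLMS1991, §3 (3.3)] [cite: WZhang2014, Notations (xii)] -/
theorem zhang_level_of_grossLevel [W.IsElliptic] [W.IsGloballyMinimal] [Fact p.Prime] [NeZero (W.conductorNorm ℤ)]
    (DtW : ModularParametrizationData W (W.conductorNorm ℤ)) {M n : ℕ} (hM : 1 ≤ M)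
    (hKol : ∀ ℓ ∈ n.primeFactors, IsKolyvaginPrime (W.conductorNorm ℤ) W K p ℓ ∧ FrobEqFrobInfty W K (p ^ M) ℓ) :
    ∀ ℓ ∈ n.primeFactors, Zhang2014.IsKolyvaginPrime (W.conductorNorm ℤ) W K p ℓ ∧ M ≤ Zhang2014.kolyvaginIndex W p ℓ :=
  fun ℓ hℓ ↦ zhang_isKolyvaginPrime_of_kolyvaginPrime W DtW (hKol ℓ hℓ).1 hM (hKol ℓ hℓ).2

/-- **Gross conductor of Frobenius level `≥ M ≥ 1` ⟹ Zhang conductor of index `≥ M`** (`ℕ∞` form: `frobLevelIndex` to `levelIndex`).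
[cite: GrossLMS1991, §3 (3.2)–(3.3)] [cite: WZhang2014, Notations (xii)] -/
theorem zhang_level_of_le_frobLevelIndex [W.IsElliptic] [W.IsGloballyMinimal] [Fact p.Prime] [NeZero (W.conductorNorm ℤ)]
    (DtW : ModularParametrizationData W (W.conductorNorm ℤ)) {M n : ℕ} (hM : 1 ≤ M)
    (hKP : ∀ ℓ ∈ n.primeFactors, IsKolyvaginPrime (W.conductorNorm ℤ) W K p ℓ)
    (hMn : (M : ℕ∞) ≤ ShimuraWalk.frobLevelIndex W K p n) :
    (∀ ℓ ∈ n.primeFactors, Zhang2014.IsKolyvaginPrime (W.conductorNorm ℤ) W K p ℓ) ∧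
      (M : ℕ∞) ≤ Zhang2014.levelIndex W p n := by
  have hfrob := (ShimuraWalk.natCast_le_frobLevelIndex_iff hKP M).mp hMn
  have hZ := zhang_level_of_grossLevel (K := K) DtW hM fun ℓ hℓ ↦ ⟨hKP ℓ hℓ, hfrob ℓ hℓ⟩
  exact ⟨fun ℓ hℓ ↦ (hZ ℓ hℓ).1, Zhang2014.natCast_le_levelIndex_iff.mpr fun ℓ hℓ ↦ (hZ ℓ hℓ).2⟩

/-- **Zhang conductor ⟹ Gross conductor on a served frame** (index `≥ 1` is part of W. Zhang's definition; `grossKolyvagin_of_zhang_of_frameProfile`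
at `k = 1`).  [cite: WZhang2014, Notations (xii)] [cite: GrossLMS1991, §3 (3.1)–(3.2)] -/
theorem grossKolyvagin_of_zhang_level_of_frameProfile [W.IsElliptic] [W.IsGloballyMinimal] [A.IsElliptic] [Fact p.Prime] [Fact q.Prime]
    (hprof : FrameProfile W A p q K) {n : ℕ}
    (hKol : ∀ ℓ ∈ n.primeFactors, Zhang2014.IsKolyvaginPrime (W.conductorNorm ℤ) W K p ℓ) :
    ∀ ℓ ∈ n.primeFactors, IsKolyvaginPrime (W.conductorNorm ℤ) W K p ℓ :=
  fun ℓ hℓ ↦ (grossKolyvagin_of_zhang_of_frameProfile hprof le_rfl (hKol ℓ hℓ)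
    (Nat.one_le_iff_ne_zero.mpr (hKol ℓ hℓ).2.2.2.2.2.ne')).1

/-- **Zhang index `≥ M ≥ 1` ⟹ Gross Frobenius level `≥ M` on a served frame** (`ℕ∞` form: `levelIndex` to `frobLevelIndex`;
`grossKolyvagin_level_of_frameProfile`).  [cite: GrossLMS1991, §3 (3.2)–(3.3)] [cite: WZhang2014, Notations (xii)] -/
theorem le_frobLevelIndex_of_le_levelIndex_of_frameProfile [W.IsElliptic] [W.IsGloballyMinimal] [A.IsElliptic] [Fact p.Prime]
    [Fact q.Prime] (hprof : FrameProfile W A p q K) {M n : ℕ} (hM : 1 ≤ M)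
    (hKol : ∀ ℓ ∈ n.primeFactors, Zhang2014.IsKolyvaginPrime (W.conductorNorm ℤ) W K p ℓ)
    (hMn : (M : ℕ∞) ≤ Zhang2014.levelIndex W p n) :
    (M : ℕ∞) ≤ ShimuraWalk.frobLevelIndex W K p n :=
  (ShimuraWalk.natCast_le_frobLevelIndex_iff (grossKolyvagin_of_zhang_level_of_frameProfile hprof hKol) M).mpr
    fun ℓ hℓ ↦ (grossKolyvagin_level_of_frameProfile hprof hM hKol hMn ℓ hℓ).2

/-! ## §2 The depth dictionary per Zhang–Kolyvagin level -/

/-- **THE DEPTH DICTIONARY** per Zhang–Kolyvagin level `n` of index `≥ k ≥ 1`, below `k` (`μ ≤ k`): every point `P(n, δ)` of the CM-presented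
genus family is `p^μ`-divisible iff `μ ≤ m'(n)` for the labelled family `ys` (`ShimuraWalk.mdiv`).  Adapter A `forall_genusDatum_pDiv_iff_pDiv`
(p730113) ∘ `ShimuraWalk.natCast_le_mdiv_iff`, with `n ⊥ N_{E′}` (`coprime_conductorNorm_E'_of_kolyvaginLevel`), the Gross primes of level `k`
(`grossKolyvagin_level_of_frameProfile`) and the weak (B4) label read off `LabelsAt` at the guard `2N_W` exactly as in
`addOrderOf_kolyvaginClass_of_genusDepth`.  Conditional on the displayed binders; nothing unconditional is asserted.
[cite: GrossLMS1991, §4 (4.1), Prop. 3.6, Prop. 3.7] [cite: McCallumLMS1991, §4 (4), §5 (p. 303)] -/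
theorem forall_genusDatum_pDiv_iff_le_mdiv_of_frameProfile [W.IsElliptic] [W.IsGloballyMinimal] [A.IsElliptic] [Fact p.Prime]
    [Fact q.Prime] [NeZero (W.conductorNorm ℤ)]
    (hG1 : ∀ (N : ℕ) [NeZero N] (W : WeierstrassCurve ℚ) (K : Type) [Field K] [NumberField K],
      phi_heegnerPointOfConductor_mem_range_map_ringClassField_birch N W K)
    (S : GenusHeegnerSettingRC W A p q K) (hprof : FrameProfile W A p q K)
    (DtW : ModularParametrizationData W (W.conductorNorm ℤ))
    {yK : (W.baseChange K).toAffine.Point}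
    {ys : (m : ℕ) → (W.baseChange (ringClassField K S.ιc m)).toAffine.Point} {ε₀ : ℤ}
    (hL : ShimuraWalk.LabelsAt W (2 * W.conductorNorm ℤ) K S.ιc yK ys ε₀)
    (hid : haveI := S.nz; haveI := S.nf; ∀ (c : ℕ), c ≠ 0 → c.Coprime (S.E'.conductorNorm ℤ) →
      ∀ δ : GenusKolyvaginDatum S.E' K S.ιc S.Dt S.β S.d₁ c,
        genusTransport W S.E' S.D S.C₂ S.hWd K S.ιc δ = ys c ∨ genusTransport W S.E' S.D S.C₂ S.hWd K S.ιc δ = -ys c)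
    {k n : ℕ} (hk : 1 ≤ k) (hn : Squarefree n)
    (hKol : ∀ ℓ ∈ n.primeFactors, Zhang2014.IsKolyvaginPrime (W.conductorNorm ℤ) W K p ℓ)
    (hkn : (k : ℕ∞) ≤ Zhang2014.levelIndex W p n) {μ : ℕ} (hμ : μ ≤ k) :
    haveI := S.nz; haveI := S.nf
    (∀ δ : GenusKolyvaginDatum S.E' K S.ιc S.Dt S.β S.d₁ n,
        ∃ z : (W.baseChange (ringClassField K S.ιc n : Type)).toAffine.Point,
          ((p ^ μ : ℕ) : ℤ) • z = genusFamilyPoint W S.E' S.D S.C₂ S.hWd K S.ιc δ) ↔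
      (μ : ℕ∞) ≤ ShimuraWalk.mdiv hprof.quad S.ιc W ys p n := by
  haveI := S.nz; haveI := S.nf
  have hK : IsImaginaryQuadratic K := hprof.quad
  have hn0 : n ≠ 0 := hn.ne_zero
  have hnE := coprime_conductorNorm_E'_of_kolyvaginLevel S hprof hn hKol
  have hKolG := grossKolyvagin_level_of_frameProfile hprof hk hKol hkn
  have hguard := guard_two_mul_level_of_frameProfile hprof hKol
  -- the weak (B4) label at level `n` for `ys`, read off `LabelsAt` at guard `2N_W` (FamilyPackage verbatim)
  have hB4 : ∀ ℓ ∈ n.primeFactors, ∀ σ : ringClassField K S.ιc n ≃ₐ[ℚ] ringClassField K S.ιc n,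
      Subgroup.zpowers σ = ringClassGalOver S.ιc n (n / ℓ) →
      ∃ y' : (W.baseChange (ringClassField K S.ιc n : Type)).toAffine.Point,
        ∑ i ∈ Finset.range (ℓ + 1), pointGalHom W (ringClassField K S.ιc n) (σ ^ i) (ys n) = W.frobeniusTrace ℓ • y' := by
    intro ℓ hℓ σ hσ
    letI : Algebra K ℂ := S.ιc.toAlgebra
    exact ⟨_, hL.2.2.2.2.1 n hn hguard ℓ hℓ
      (ringClassField_mono hK S.ιc (Nat.div_dvd_of_dvd (Nat.dvd_of_mem_primeFactors hℓ)) hn0) σ hσ⟩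
  rw [ShimuraWalk.natCast_le_mdiv_iff]
  exact forall_genusDatum_pDiv_iff_pDiv hG1 S hK DtW hk hn hnE hKolG ys hB4 (hid n hn0 hnE) hμ

/-! ## §3 The transport of the swap supply: Gross currency ⟹ Zhang currency -/

/-- **THE TRANSPORT.**  On a served frame with modularity data `DtW` and the labels `hL` ∕ `hid` of `GenusLabelsSupplyOddAt`, an abstract swap
supply for the labelled family in GROSS currency (`hsw : ShimuraWalk.SwapSupplyAt hprof.quad S.ιc W N_W p ys` — McCallum Prop. 5.2 in Kolyvagin's
redefinition currency; a tree theorem on every served frame by imc-p1's `ShimuraWalk.genusSwapSupplyAt_of_frameProfile`, not used here) gives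
the swap statement in ZHANG currency for EVERY depth function `mdiv` on the square-free Zhang–Kolyvagin conductors characterised by the
`p^u`-divisibility of all the points `P(c, δ)` — VERBATIM the binder `hswap` of `genusKolyvaginPointDivAtP_of_swap_of_prop53_of_thm63` at this
frame.  Proof: §1 moves conductors between the currencies, §2 moves the depth statements at depth `μ` ∕ `μ+1 ≤ M(c)`; `hsw` is applied at
`e' := max e (μ+1)`.  Conditional on the displayed binders; nothing unconditional is asserted; BSD is proved for no curve.
[cite: McCallumLMS1991, §5 Prop. 5.2 (pp. 304–306)] [cite: GrossLMS1991, §3 (3.1)–(3.3)] [cite: WZhang2014, Notations (xii)] [cite: Jetchev2008, §3.1 item 5] -/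
theorem genusSwapZhang_of_swapSupplyAt [W.IsElliptic] [W.IsGloballyMinimal] [A.IsElliptic] [Fact p.Prime] [Fact q.Prime]
    [NeZero (W.conductorNorm ℤ)]
    (hG1 : ∀ (N : ℕ) [NeZero N] (W : WeierstrassCurve ℚ) (K : Type) [Field K] [NumberField K],
      phi_heegnerPointOfConductor_mem_range_map_ringClassField_birch N W K)
    (S : GenusHeegnerSettingRC W A p q K) (hprof : FrameProfile W A p q K)
    (DtW : ModularParametrizationData W (W.conductorNorm ℤ))
    {yK : (W.baseChange K).toAffine.Point}
    {ys : (m : ℕ) → (W.baseChange (ringClassField K S.ιc m)).toAffine.Point} {ε₀ : ℤ}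
    (hL : ShimuraWalk.LabelsAt W (2 * W.conductorNorm ℤ) K S.ιc yK ys ε₀)
    (hid : haveI := S.nz; haveI := S.nf; ∀ (c : ℕ), c ≠ 0 → c.Coprime (S.E'.conductorNorm ℤ) →
      ∀ δ : GenusKolyvaginDatum S.E' K S.ιc S.Dt S.β S.d₁ c,
        genusTransport W S.E' S.D S.C₂ S.hWd K S.ιc δ = ys c ∨ genusTransport W S.E' S.D S.C₂ S.hWd K S.ιc δ = -ys c)
    (hsw : ShimuraWalk.SwapSupplyAt hprof.quad S.ιc W (W.conductorNorm ℤ) p ys)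
    (mdiv : {c : ℕ // Squarefree c ∧
        ∀ ℓ ∈ c.primeFactors, Zhang2014.IsKolyvaginPrime (W.conductorNorm ℤ) W K p ℓ} → ℕ∞)
    (hchar : haveI := S.nz; haveI := S.nf
      ∀ c (u : ℕ), (u : ℕ∞) ≤ mdiv c ↔ ∀ δ : GenusKolyvaginDatum S.E' K S.ιc S.Dt S.β S.d₁ c.1,
        ∃ z : (W.baseChange (ringClassField K S.ιc c.1)).toAffine.Point,
          ((p ^ u : ℕ) : ℤ) • z = genusFamilyPoint W S.E' S.D S.C₂ S.hWd K S.ιc δ)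
    (μ e : ℕ) (c : {c : ℕ // Squarefree c ∧
        ∀ ℓ ∈ c.primeFactors, Zhang2014.IsKolyvaginPrime (W.conductorNorm ℤ) W K p ℓ})
    (h1 : ((μ + 1 : ℕ) : ℕ∞) ≤ Zhang2014.levelIndex W p c.1)
    (h2 : ∀ c' : {c : ℕ // Squarefree c ∧
        ∀ ℓ ∈ c.primeFactors, Zhang2014.IsKolyvaginPrime (W.conductorNorm ℤ) W K p ℓ},
      ((μ + 1 : ℕ) : ℕ∞) ≤ Zhang2014.levelIndex W p c'.1 → (μ : ℕ∞) ≤ mdiv c')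
    (h3 : ¬ ((μ + 1 : ℕ) : ℕ∞) ≤ mdiv c) :
    ∃ c' : {c : ℕ // Squarefree c ∧
        ∀ ℓ ∈ c.primeFactors, Zhang2014.IsKolyvaginPrime (W.conductorNorm ℤ) W K p ℓ},
      (e : ℕ∞) ≤ Zhang2014.levelIndex W p c'.1 ∧ ¬ ((μ + 1 : ℕ) : ℕ∞) ≤ mdiv c' := by
  haveI := S.nz; haveI := S.nf
  have hK : IsImaginaryQuadratic K := hprof.quad
  have hμ1 : 1 ≤ μ + 1 := Nat.le_add_left 1 μ
  -- the depth dictionary at a Zhang conductor of index `≥ μ + 1`, at depths `μ` and `μ + 1`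
  have hdict : ∀ (c' : {c : ℕ // Squarefree c ∧
      ∀ ℓ ∈ c.primeFactors, Zhang2014.IsKolyvaginPrime (W.conductorNorm ℤ) W K p ℓ}),
      ((μ + 1 : ℕ) : ℕ∞) ≤ Zhang2014.levelIndex W p c'.1 → ∀ u, u ≤ μ + 1 →
        ((u : ℕ∞) ≤ mdiv c' ↔ (u : ℕ∞) ≤ ShimuraWalk.mdiv hK S.ιc W ys p c'.1) := by
    intro c' hc' u hu
    rw [hchar c' u]
    exact forall_genusDatum_pDiv_iff_le_mdiv_of_frameProfile hG1 S hprof DtW hL hid hμ1 c'.2.1 c'.2.2 hc' hu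
  -- `c` as a Gross conductor of Frobenius level `≥ μ + 1`
  let cG : ShimuraWalk.Conductor W K (W.conductorNorm ℤ) p :=
    ⟨c.1, c.2.1, grossKolyvagin_of_zhang_level_of_frameProfile hprof c.2.2⟩
  have h1G : ((μ + 1 : ℕ) : ℕ∞) ≤ ShimuraWalk.frobLevelIndex W K p cG.1 :=
    le_frobLevelIndex_of_le_levelIndex_of_frameProfile hprof hμ1 c.2.2 h1
  -- hypothesis (2) in Gross currency
  have h2G : ∀ c' : ShimuraWalk.Conductor W K (W.conductorNorm ℤ) p,
      ((μ + 1 : ℕ) : ℕ∞) ≤ ShimuraWalk.frobLevelIndex W K p c'.1 →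
        (μ : ℕ∞) ≤ ShimuraWalk.mdiv hK S.ιc W ys p c'.1 := by
    intro c' hc'
    obtain ⟨hZ, hMZ⟩ := zhang_level_of_le_frobLevelIndex (K := K) DtW hμ1 c'.2.2 hc'
    let cZ : {c : ℕ // Squarefree c ∧
        ∀ ℓ ∈ c.primeFactors, Zhang2014.IsKolyvaginPrime (W.conductorNorm ℤ) W K p ℓ} := ⟨c'.1, c'.2.1, hZ⟩
    exact (hdict cZ hMZ μ (Nat.le_succ μ)).mp (h2 cZ hMZ)
  -- hypothesis (3) in Gross currency
  have h3G : ¬ ((μ + 1 : ℕ) : ℕ∞) ≤ ShimuraWalk.mdiv hK S.ιc W ys p cG.1 :=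
    fun h ↦ h3 ((hdict c h1 (μ + 1) le_rfl).mpr h)
  -- the Gross swap at `e' := max e (μ + 1)`
  obtain ⟨c'', hMc'', hnd''⟩ := hsw μ (max e (μ + 1)) cG h1G h2G h3G
  have hMc''1 : ((μ + 1 : ℕ) : ℕ∞) ≤ ShimuraWalk.frobLevelIndex W K p c''.1 :=
    le_trans (by exact_mod_cast le_max_right e (μ + 1)) hMc''
  have hMc''e : ((max e (μ + 1) : ℕ) : ℕ∞) ≤ ShimuraWalk.frobLevelIndex W K p c''.1 := by exact_mod_cast hMc''
  obtain ⟨hZ'', hMZ''⟩ := zhang_level_of_le_frobLevelIndex (K := K) DtW (hμ1.trans (le_max_right e (μ + 1))) c''.2.2 hMc''e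
  let cZ'' : {c : ℕ // Squarefree c ∧
      ∀ ℓ ∈ c.primeFactors, Zhang2014.IsKolyvaginPrime (W.conductorNorm ℤ) W K p ℓ} := ⟨c''.1, c''.2.1, hZ''⟩
  have hMZ''1 : ((μ + 1 : ℕ) : ℕ∞) ≤ Zhang2014.levelIndex W p cZ''.1 :=
    le_trans (by exact_mod_cast le_max_right e (μ + 1)) hMZ''
  refine ⟨cZ'', le_trans (by exact_mod_cast le_max_left e (μ + 1)) hMZ'', fun h ↦ hnd'' ?_⟩
  exact (hdict cZ'' hMZ''1 (μ + 1) le_rfl).mp h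

end Summit.BirchSwinnertonDyer.BirchSwinnertonDyer.Theorems.GenusLine

end
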